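import Mathlib.Analysis.SpecialFunctions.Pow.Real
import Literature.NumberTheory.ConnesConsani2023.RiemannRochSpecZProofs
import Literature.NumberTheory.ConnesConsani2023.RiemannRochSpecZDimH0
import HarnessLib

/-!
# Connes–Consani, Riemann–Roch for `Spec ℤ̄` (2023) — PROOF of the Riemann–Roch formula (Theorem 4.3 = Theorem 1.1)

Discharges the named fact `Literature.NumberTheory.ConnesConsani2023.RiemannRoch_SpecZbar`
(A. Connes, C. Consani, *Riemann–Roch for `\overline{Spec ℤ}`*, Bull. Sci. Math. 187 (2023) 103293 =
arXiv:2205.01391, Thm. 4.3 p. 10 [bib: `ConnesConsani2023RiemannRoch`]):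
for every Arakelov divisor `D` on `\overline{Spec ℤ}`,
`dim_{𝕊[±1]} H⁰(D) − dim_{𝕊[±1]} H¹(D) = ⌈(deg D + log 2)/log 3⌉' − 𝟙_L(deg D)`.

We FOLLOW THE PRINTED PROOF (proof of Thm. 3.4, p. 9, and of Thm. 4.3, p. 10), using the two propositions
already proved in the tree: Prop. 3.3 (i) (`dim_HZnorm_eq_holds`, file `RiemannRochSpecZDimH0`) and Prop. 4.1
(`dim_U1_eq_holds`, file `RiemannRochSpecZProofs`).
* Reduction to `D ∼ (deg D){∞}` (Prop. 2.2 (iii)): in the typed objects this is the rescaling `x ↦ x / gen D`,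
  `L = gen D · ℤ`, with `e^{a} / gen D = e^{deg D}` (`ArakelovDivisor.exp_deg`); `dim_{𝕊[±1]}` of `‖HL‖_λ` is
  invariant under rescaling (`pmDim_smul`) and, on integer points, depends only on `⌊λ⌋` (`pmGenerates_int_iff`),
  whence `dim H⁰(D) = dim ‖Hℤ‖_n`, `n = ⌊e^{deg D}⌋` (`dimH0_eq`); likewise the circle `ℝ/(gen D)ℤ` with bound
  `e^a` rescales isometrically (up to the factor) to `ℝ/ℤ` with bound `e^{deg D}` (`norm_equivAddCircle`,
  `pmTolDim_equiv`), whence `dim H¹(D) = dim U(1)_{e^{deg D}}` (`dimH1_eq`).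
* `deg D ≥ −log 2` (`λ = e^{deg D} ≥ ½`): `H¹ = 0` (Prop. 4.1) and the computation of the proof of Thm. 3.4:
  with `2λ = 3^t`, if `a ∈ L` then `2λ ∈ (3^k, 3^k+1)`, `n = (3^k−1)/2`, `⌈log₃(2n+1)⌉ = k = ⌈t⌉ − 1`
  (`mem_excSet_iff`, `two_floor_add_one`); if `a ∉ L` then `3^k < 2n+1 ≤ 3^{k+1}` with `k + 1 = ⌈t⌉`
  (`ceil_log3_eq`; the boundary value `λ = ½` separately).
* `deg D < −log 2`: `H⁰ = 0` (`n = 0`), `deg D ∉ L`, and `−dim H¹ = −⌈(−log λ − log 2)/log 3⌉ = ⌈(deg D + log 2)/log 3⌉'`.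

Cell `pub-rhdoor` (motivic door), seat cc-2.  With this file the 2023 Riemann–Roch theorem for the CURVE
`\overline{Spec ℤ}` is a machine-checked Literature theorem (axioms `propext`, `Classical.choice`, `Quot.sound`);
it is a statement about integer-valued dimensions of `𝕊[±1]`-modules and has no bearing on RH (see the cell's
CC-MAP §4).
-/

noncomputable section

open Finset Set

namespace Literature.NumberTheory.ConnesConsani2023

/-! ## Step 1: `exp (deg D) = exp a / gen D` -/

/-- `e^{deg D} = e^{a} / gen D` (`gen D = Π p^{-a_p}`): the norm bound after rescaling the lattice `L = gen D · ℤ`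
to `ℤ` ("Let a = deg D and n = ⌊exp(deg D)⌋, then H⁰(D) = ‖Hℤ‖_n", proof of Thm. 3.4). [cite: ConnesConsani2023RiemannRoch, Thm. 3.4 p. 9] -/
theorem ArakelovDivisor.exp_deg (D : ArakelovDivisor) :
    Real.exp D.deg = Real.exp D.inf / D.gen := by
  have hgen : 0 < D.gen := D.gen_pos
  rw [eq_div_iff hgen.ne', ArakelovDivisor.deg, Real.exp_add, ArakelovDivisor.gen]
  -- `exp (Σ a_p log p) · Π p^{-a_p} = 1`
  suffices h : Real.exp (D.fin.sum fun p a => (a : ℝ) * Real.log p) *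
      (D.fin.prod fun p a => (p : ℝ) ^ (-a)) = 1 by
    calc Real.exp (D.fin.sum fun p a => (a : ℝ) * Real.log p) * Real.exp D.inf *
          (D.fin.prod fun p a => (p : ℝ) ^ (-a))
        = Real.exp D.inf * (Real.exp (D.fin.sum fun p a => (a : ℝ) * Real.log p) *
          (D.fin.prod fun p a => (p : ℝ) ^ (-a))) := by ring
      _ = Real.exp D.inf := by rw [h, mul_one]
  unfold Finsupp.sum Finsupp.prod
  rw [Real.exp_sum, ← Finset.prod_mul_distrib]
  refine Finset.prod_eq_one fun p hp => ?_
  have hp0 : (0 : ℝ) < p := by exact_mod_cast (D.prime_of_mem_support p hp).pos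
  beta_reduce
  rw [mul_comm ((D.fin p : ℤ) : ℝ), ← Real.rpow_def_of_pos hp0, ← Real.rpow_intCast,
    ← Real.rpow_add hp0]
  simp

/-! ## Step 2: scaling and integrality of the normed generation -/

/-- Generation of `‖HL‖_λ` is invariant under rescaling `x ↦ c x` (`c > 0`) of the lattice, the bound and the
generating set. [folklore] -/
theorem pmGenerates_smul {E : Set ℝ} {lam c : ℝ} (hc : 0 < c) {F : Finset ℝ}
    (h : PmGenerates E lam F) :
    PmGenerates ((fun x => c * x) '' E) (c * lam) (F.image fun x => c * x) := by
  classical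
  obtain ⟨hFE, hgen⟩ := h
  refine ⟨?_, ?_⟩
  · intro y hy
    obtain ⟨x, hx, rfl⟩ := Finset.mem_image.mp (Finset.mem_coe.mp hy)
    exact ⟨x, hFE (Finset.mem_coe.mpr hx), rfl⟩
  · rintro y ⟨x, hx, rfl⟩
    obtain ⟨α, hα, hsum, hnorm⟩ := hgen x hx
    have hinj : ∀ a ∈ F, ∀ b ∈ F, c * a = c * b → a = b :=
      fun a _ b _ hab => mul_left_cancel₀ hc.ne' hab
    refine ⟨fun z => α (z / c), ?_, ?_, ?_⟩
    · intro z hz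
      obtain ⟨j, hj, rfl⟩ := Finset.mem_image.mp hz
      simp only [mul_div_cancel_left₀ _ hc.ne']
      exact hα j hj
    · rw [Finset.sum_image hinj]
      simp only [mul_div_cancel_left₀ _ hc.ne']
      rw [hsum, Finset.mul_sum]
      exact Finset.sum_congr rfl fun j _ => by ring
    · rw [Finset.sum_image hinj]
      simp only [mul_div_cancel_left₀ _ hc.ne']
      have : ∀ j ∈ F, |(α j : ℝ) * (c * j)| = c * |(α j : ℝ) * j| := by
        intro j _
        rw [show (α j : ℝ) * (c * j) = c * ((α j : ℝ) * j) by ring, abs_mul, abs_of_pos hc]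
      rw [Finset.sum_congr rfl this, ← Finset.mul_sum]
      exact mul_le_mul_of_nonneg_left hnorm hc.le

/-- `dim_{𝕊[±1]}` is invariant under rescaling (both directions of `pmGenerates_smul`). [folklore] -/
theorem pmDim_smul {E : Set ℝ} {lam c : ℝ} (hc : 0 < c) :
    pmDim ((fun x => c * x) '' E) (c * lam) = pmDim E lam := by
  classical
  unfold pmDim
  congr 1
  ext k
  constructor
  · rintro ⟨G, hG, hgen⟩
    have h := pmGenerates_smul (inv_pos.mpr hc) hgen
    have hE : (fun x => c⁻¹ * x) '' ((fun x => c * x) '' E) = E := by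
      rw [Set.image_image]; simp [inv_mul_cancel_left₀ hc.ne']
    rw [hE, inv_mul_cancel_left₀ hc.ne'] at h
    refine ⟨_, ?_, h⟩
    rw [Finset.card_image_of_injective _ fun a b hab => mul_left_cancel₀ (inv_ne_zero hc.ne') hab]
    exact hG
  · rintro ⟨G, hG, hgen⟩
    refine ⟨_, ?_, pmGenerates_smul hc hgen⟩
    rw [Finset.card_image_of_injective _ fun a b hab => mul_left_cancel₀ hc.ne' hab]
    exact hG

/-- Rescaling `H⁰(D)(1_+) = {x ∈ L : |x| ≤ e^a}` by `gen D⁻¹` gives `{m ∈ ℤ : |m| ≤ e^{deg D}}` (reduction to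
`D ∼ (deg D){∞}`, Prop. 2.2 (iii) / proof of Thm. 3.4). [cite: ConnesConsani2023RiemannRoch, Thm. 3.4 p. 9] -/
theorem ArakelovDivisor.smul_H0set (D : ArakelovDivisor) :
    (fun x => D.gen⁻¹ * x) '' D.H0set = {y : ℝ | (∃ m : ℤ, y = m) ∧ |y| ≤ Real.exp D.deg} := by
  have hgen : 0 < D.gen := D.gen_pos
  rw [D.exp_deg]
  ext y
  constructor
  · rintro ⟨x, ⟨⟨m, rfl⟩, hx⟩, rfl⟩
    refine ⟨⟨m, by field_simp⟩, ?_⟩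
    rw [abs_mul, abs_of_pos (inv_pos.mpr hgen), div_eq_inv_mul]
    exact mul_le_mul_of_nonneg_left hx (inv_pos.mpr hgen).le
  · rintro ⟨⟨m, rfl⟩, hm⟩
    refine ⟨m * D.gen, ⟨⟨m, rfl⟩, ?_⟩, by field_simp⟩
    rw [abs_mul, abs_of_pos hgen]
    rw [le_div_iff₀ hgen] at hm
    exact hm

/-- Integrality: for integer points the real bound `λ ≥ 0` may be replaced by `⌊λ⌋₊` both for the level set
and for the (integer-valued) norms, i.e. `‖Hℤ‖_λ = ‖Hℤ‖_{⌊λ⌋}`. [folklore] -/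
theorem pmGenerates_int_iff {lam : ℝ} (hlam : 0 ≤ lam) (F : Finset ℝ) :
    PmGenerates {y : ℝ | (∃ m : ℤ, y = m) ∧ |y| ≤ lam} lam F ↔
      PmGenerates (HZball ⌊lam⌋₊) (⌊lam⌋₊ : ℝ) F := by
  have hn : (⌊lam⌋₊ : ℝ) ≤ lam := Nat.floor_le hlam
  -- the two level sets coincide
  have hE : {y : ℝ | (∃ m : ℤ, y = m) ∧ |y| ≤ lam} = HZball ⌊lam⌋₊ := by
    ext y
    simp only [HZball, Set.mem_setOf_eq]
    constructor
    · rintro ⟨⟨m, rfl⟩, hm⟩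
      refine ⟨⟨m, rfl⟩, ?_⟩
      have h1 : (|m| : ℤ) ≤ ⌊lam⌋ := Int.le_floor.mpr (by push_cast; exact hm)
      have h2 : ((⌊lam⌋ : ℤ) : ℝ) = (⌊lam⌋₊ : ℝ) := by
        rw [← Int.natCast_floor_eq_floor hlam]; simp
      rw [← Int.cast_abs, ← h2]
      exact_mod_cast h1
    · rintro ⟨⟨m, rfl⟩, hm⟩
      exact ⟨⟨m, rfl⟩, hm.trans hn⟩
  rw [hE]
  constructor
  · rintro ⟨hF, hgen⟩
    refine ⟨hF, fun x hx => ?_⟩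
    obtain ⟨α, hα, hsum, hnorm⟩ := hgen x hx
    refine ⟨α, hα, hsum, ?_⟩
    -- the norm is an integer
    have hint : ∀ j ∈ F, |(α j : ℝ) * j| = (((|α j * ⌊j⌋| : ℤ)) : ℝ) := by
      intro j hj
      obtain ⟨⟨m, hm⟩, -⟩ := hF (Finset.mem_coe.mpr hj)
      rw [hm, Int.floor_intCast]; push_cast; rfl
    rw [Finset.sum_congr rfl hint] at hnorm ⊢
    rw [← Int.cast_sum] at hnorm ⊢
    have h1 : (∑ j ∈ F, |α j * ⌊j⌋|) ≤ ⌊lam⌋ := Int.le_floor.mpr hnorm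
    have h2 : ((⌊lam⌋ : ℤ) : ℝ) = (⌊lam⌋₊ : ℝ) := by
      rw [← Int.natCast_floor_eq_floor hlam]; simp
    rw [← h2]
    exact_mod_cast h1
  · rintro ⟨hF, hgen⟩
    refine ⟨hF, fun x hx => ?_⟩
    obtain ⟨α, hα, hsum, hnorm⟩ := hgen x hx
    exact ⟨α, hα, hsum, hnorm.trans hn⟩

/-- `dim H⁰(D) = dim ‖Hℤ‖_n`, `n = ⌊e^{deg D}⌋` (proof of Thm. 3.4: "then H⁰(D) = ‖Hℤ‖_n"). [cite: ConnesConsani2023RiemannRoch, Thm. 3.4 p. 9] -/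
theorem dimH0_eq (D : ArakelovDivisor) : dimH0 D = pmDim (HZball ⌊Real.exp D.deg⌋₊) ⌊Real.exp D.deg⌋₊ := by
  have hgen : 0 < D.gen := D.gen_pos
  unfold dimH0
  rw [← pmDim_smul (inv_pos.mpr hgen) (E := D.H0set) (lam := Real.exp D.inf), D.smul_H0set,
    show D.gen⁻¹ * Real.exp D.inf = Real.exp D.deg by rw [D.exp_deg]; ring]
  unfold pmDim
  congr 1
  ext k
  simp only [Set.mem_setOf_eq, pmGenerates_int_iff (Real.exp_pos _).le]

/-! ## Step 3: rescaling the circle -/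

/-- The rescaling `AddCircle p ≃+ AddCircle q` multiplies norms by `q/p`. [folklore] -/
theorem norm_equivAddCircle {p q : ℝ} (hp : 0 < p) (hq : 0 < q) (x : AddCircle p) :
    ‖AddCircle.equivAddCircle p q hp.ne' hq.ne' x‖ = q / p * ‖x‖ := by
  induction x using QuotientAddGroup.induction_on with
  | H y =>
    rw [AddCircle.equivAddCircle_apply_mk, AddCircle.norm_eq, AddCircle.norm_eq]
    have h1 : q⁻¹ * (y * (p⁻¹ * q)) = p⁻¹ * y := by field_simp
    rw [h1, show y * (p⁻¹ * q) - round (p⁻¹ * y) * q = q / p * (y - round (p⁻¹ * y) * p) by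
      field_simp, abs_mul, abs_of_pos (div_pos hq hp)]

/-- The rescaling `AddCircle p ≃+ AddCircle q` multiplies distances by `q/p`. [folklore] -/
theorem dist_equivAddCircle {p q : ℝ} (hp : 0 < p) (hq : 0 < q) (x y : AddCircle p) :
    dist (AddCircle.equivAddCircle p q hp.ne' hq.ne' x) (AddCircle.equivAddCircle p q hp.ne' hq.ne' y)
      = q / p * dist x y := by
  rw [dist_eq_norm, dist_eq_norm, ← map_sub, norm_equivAddCircle hp hq]

/-- Tolerant generation is transported by the rescaling of circles (bound scaled by `q/p`). [folklore] -/
theorem pmTolGenerates_equiv {p q : ℝ} (hp : 0 < p) (hq : 0 < q) {lam : ℝ}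
    {F : Finset (AddCircle p)} (h : PmTolGenerates lam F) :
    PmTolGenerates (q / p * lam) (F.image (AddCircle.equivAddCircle p q hp.ne' hq.ne')) := by
  classical
  set φ := AddCircle.equivAddCircle p q hp.ne' hq.ne' with hφ
  obtain ⟨hsep, hcov⟩ := h
  have hqp : 0 < q / p := div_pos hq hp
  refine ⟨?_, ?_⟩
  · intro x hx y hy hxy
    obtain ⟨a, ha, rfl⟩ := Finset.mem_image.mp hx
    obtain ⟨b, hb, rfl⟩ := Finset.mem_image.mp hy
    have hab : a ≠ b := fun h => hxy (by rw [h])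
    rw [dist_equivAddCircle hp hq]
    exact mul_lt_mul_of_pos_left (hsep a ha b hb hab) hqp
  · intro z
    obtain ⟨x, rfl⟩ := φ.surjective z
    obtain ⟨α, hα, hdist⟩ := hcov x
    refine ⟨fun w => α (φ.symm w), ?_, ?_⟩
    · intro w hw
      obtain ⟨j, hj, rfl⟩ := Finset.mem_image.mp hw
      simp only [AddEquiv.symm_apply_apply]
      exact hα j hj
    · rw [Finset.sum_image fun a _ b _ hab => φ.injective hab]
      simp only [φ.symm_apply_apply]
      have : ∑ j ∈ F, α j • φ j = φ (∑ j ∈ F, α j • j) := by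
        rw [map_sum]; exact Finset.sum_congr rfl fun j _ => (map_zsmul φ _ _).symm
      rw [this, dist_equivAddCircle hp hq]
      exact mul_le_mul_of_nonneg_left hdist hqp.le

/-- `dim_{𝕊[±1]} (ℝ/qℤ, d)_{(q/p)λ} = dim_{𝕊[±1]} (ℝ/pℤ, d)_λ`. [folklore] -/
theorem pmTolDim_equiv {p q : ℝ} (hp : 0 < p) (hq : 0 < q) (lam : ℝ) :
    pmTolDim (AddCircle q) (q / p * lam) = pmTolDim (AddCircle p) lam := by
  classical
  unfold pmTolDim
  congr 1
  ext k
  constructor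
  · rintro ⟨G, hG, hgen⟩
    have h := pmTolGenerates_equiv hq hp hgen
    rw [show p / q * (q / p * lam) = lam by field_simp] at h
    refine ⟨_, ?_, h⟩
    rw [Finset.card_image_of_injective _ (AddCircle.equivAddCircle q p hq.ne' hp.ne').injective]
    exact hG
  · rintro ⟨G, hG, hgen⟩
    refine ⟨_, ?_, pmTolGenerates_equiv hp hq hgen⟩
    rw [Finset.card_image_of_injective _ (AddCircle.equivAddCircle p q hp.ne' hq.ne').injective]
    exact hG

/-- `dim H¹(D) = dim U(1)_{e^{deg D}}` (proof of Thm. 4.3: "dim H¹(D) = dim U(1)_λ for λ = exp(deg(D))").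
[cite: ConnesConsani2023RiemannRoch, Thm. 4.3 p. 10] -/
theorem dimH1_eq (D : ArakelovDivisor) : dimH1 D = pmTolDim (AddCircle (1 : ℝ)) (Real.exp D.deg) := by
  have hgen : 0 < D.gen := D.gen_pos
  unfold dimH1
  rw [← pmTolDim_equiv hgen one_pos (Real.exp D.inf), D.exp_deg]
  congr 1
  ring

/-! ## Step 4: the Riemann–Roch formula -/


/-- `3^j < N ≤ 3^{j+1}` ⇒ `⌈log N / log 3⌉ = j + 1`. [folklore] -/
theorem ceil_log3_eq {N j : ℕ} (h1 : 3 ^ j < N) (h2 : N ≤ 3 ^ (j + 1)) :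
    ⌈Real.log N / Real.log 3⌉ = (j : ℤ) + 1 := by
  have hlog3 : 0 < Real.log 3 := Real.log_pos (by norm_num)
  have hN : (0 : ℝ) < N := by exact_mod_cast (lt_of_le_of_lt (Nat.zero_le _) h1)
  rw [Int.ceil_eq_iff]
  push_cast
  constructor
  · rw [lt_div_iff₀ hlog3]
    have h : (3 : ℝ) ^ j < N := by exact_mod_cast h1
    have := Real.log_lt_log (by positivity) h
    rw [Real.log_pow] at this
    linarith
  · rw [div_le_iff₀ hlog3]
    have h : (N : ℝ) ≤ (3 : ℝ) ^ (j + 1) := by exact_mod_cast h2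
    have := Real.log_le_log hN h
    rw [Real.log_pow] at this
    push_cast at this
    linarith

/-- Membership in the exceptional set `L` in terms of `λ = e^{a}`: `a ∈ L ⟺ ∃ k, 3^k < 2λ < 3^k + 1`
(proof of Thm. 3.4: "a + log 2 ∈ (k log 3, k log 3 + ε_k) … 2 exp a ∈ (3^k, 3^k + 1)"). [cite: ConnesConsani2023RiemannRoch, Thm. 3.4 p. 9] -/
theorem mem_excSet_iff {a : ℝ} :
    a ∈ excSet ↔ ∃ k : ℕ, (3 : ℝ) ^ k < 2 * Real.exp a ∧ 2 * Real.exp a < 3 ^ k + 1 := by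
  have hlam : 0 < Real.exp a := Real.exp_pos a
  have hlog2lam : Real.log (2 * Real.exp a) = a + Real.log 2 := by
    rw [Real.log_mul (by norm_num) hlam.ne', Real.log_exp]; ring
  have key : ∀ k : ℕ, (a ∈ Set.Ioo ((k : ℝ) * Real.log 3 - Real.log 2)
      ((k : ℝ) * Real.log 3 + Real.log (1 + (3 : ℝ) ^ (-(k : ℤ))) - Real.log 2)) ↔
      ((3 : ℝ) ^ k < 2 * Real.exp a ∧ 2 * Real.exp a < 3 ^ k + 1) := by
    intro k
    have h3k : (0 : ℝ) < 3 ^ k := by positivity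
    have hsum : (k : ℝ) * Real.log 3 + Real.log (1 + (3 : ℝ) ^ (-(k : ℤ))) = Real.log (3 ^ k + 1) := by
      rw [← Real.log_pow, ← Real.log_mul (by positivity) (by positivity)]
      congr 1
      rw [zpow_neg, zpow_natCast]
      field_simp
    rw [Set.mem_Ioo, hsum]
    constructor
    · rintro ⟨h1, h2⟩
      constructor
      · have : Real.log ((3 : ℝ) ^ k) < Real.log (2 * Real.exp a) := by
          rw [Real.log_pow, hlog2lam]; linarith
        exact (Real.log_lt_log_iff h3k (by positivity)).mp this
      · have : Real.log (2 * Real.exp a) < Real.log (3 ^ k + 1) := by rw [hlog2lam]; linarith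
        exact (Real.log_lt_log_iff (by positivity) (by positivity)).mp this
    · rintro ⟨h1, h2⟩
      constructor
      · have := Real.log_lt_log h3k h1
        rw [Real.log_pow, hlog2lam] at this; linarith
      · have := Real.log_lt_log (by positivity) h2
        rw [hlog2lam] at this; linarith
  simp only [excSet, Set.mem_iUnion, key]

/-- If `3^k < 2λ < 3^k + 1` then `n = ⌊λ⌋ = (3^k − 1)/2`, i.e. `2n + 1 = 3^k` (proof of Thm. 3.4). [cite: ConnesConsani2023RiemannRoch, Thm. 3.4 p. 9] -/
theorem two_floor_add_one {lam : ℝ} (hlam : 0 ≤ lam) {k : ℕ}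
    (h1 : (3 : ℝ) ^ k < 2 * lam) (h2 : 2 * lam < 3 ^ k + 1) : 2 * ⌊lam⌋₊ + 1 = 3 ^ k := by
  obtain ⟨q, hq⟩ : Odd (3 ^ k) := Odd.pow (by decide)
  have hqR : ((3 : ℝ) ^ k) = 2 * q + 1 := by exact_mod_cast hq
  have hfl : ⌊lam⌋₊ = q := by
    rw [Nat.floor_eq_iff hlam]
    constructor <;> linarith
  omega

/-- **Theorem 4.3 (= Thm. 1.1) of Connes–Consani 2023 — Riemann–Roch for `Spec ℤ̄` — PROVED** from
Prop. 3.3 (i) (hypothesis `h33`, discharged below by `dim_HZnorm_eq_holds`) and Prop. 4.1 (`dim_U1_eq_holds`),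
following the printed proofs of Thm. 3.4 and Thm. 4.3. [cite: ConnesConsani2023RiemannRoch, Thm. 4.3 p. 10] -/
theorem RiemannRoch_SpecZbar_holds' (h33 : dim_HZnorm_eq) : RiemannRoch_SpecZbar := by
  intro D
  have hlog3 : 0 < Real.log 3 := Real.log_pos (by norm_num)
  have hlog2 : 0 < Real.log 2 := Real.log_pos (by norm_num)
  set a := D.deg with ha
  set lam := Real.exp a with hlam
  have hlam0 : 0 < lam := Real.exp_pos a
  have hloglam : Real.log lam = a := Real.log_exp a
  have hlog2lam : Real.log (2 * lam) = a + Real.log 2 := by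
    rw [Real.log_mul (by norm_num) hlam0.ne', hloglam]; ring
  rw [dimH0_eq, dimH1_eq, h33]
  set n := ⌊lam⌋₊ with hn
  obtain ⟨hU1a, hU1b⟩ := dim_U1_eq_holds lam hlam0
  by_cases hcase : 1 / 2 ≤ lam
  · -- `deg D ≥ -log 2`: `H¹ = 0`
    rw [hU1b hcase]
    have ht0 : 0 ≤ (a + Real.log 2) / Real.log 3 := by
      apply div_nonneg _ hlog3.le
      have : Real.log (1 / 2) ≤ Real.log lam := Real.log_le_log (by norm_num) hcase
      rw [one_div, Real.log_inv, hloglam] at this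
      linarith
    rw [oddCeil, if_pos ht0]
    by_cases hL : a ∈ excSet
    · rw [Set.indicator_of_mem hL]
      obtain ⟨k, hk1, hk2⟩ := mem_excSet_iff.mp hL
      have h2n : 2 * n + 1 = 3 ^ k := two_floor_add_one hlam0.le hk1 hk2
      have hH0 : ⌈Real.log (2 * (n : ℝ) + 1) / Real.log 3⌉ = k := by
        have : (2 * (n : ℝ) + 1) = (3 : ℝ) ^ k := by exact_mod_cast h2n
        rw [this, Real.log_pow, mul_div_assoc, div_self hlog3.ne', mul_one]
        exact Int.ceil_natCast k
      have ht : ⌈(a + Real.log 2) / Real.log 3⌉ = (k : ℤ) + 1 := by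
        rw [Int.ceil_eq_iff]
        push_cast
        constructor
        · rw [lt_div_iff₀ hlog3]
          have := Real.log_lt_log (by positivity) hk1
          rw [Real.log_pow, hlog2lam] at this
          linarith
        · rw [div_le_iff₀ hlog3]
          have h3 : 2 * lam < (3 : ℝ) ^ (k + 1) := by
            have : (1 : ℝ) ≤ 3 ^ k := one_le_pow₀ (by norm_num)
            rw [pow_succ]; linarith
          have := Real.log_lt_log (by positivity) h3
          rw [Real.log_pow, hlog2lam] at this
          push_cast at this
          linarith
      rw [hH0, ht]
      push_cast
      ring
    · rw [Set.indicator_of_notMem hL]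
      have hnotL : ∀ k : ℕ, (3 : ℝ) ^ k < 2 * lam → (3 : ℝ) ^ k + 1 ≤ 2 * lam := by
        intro k hk
        by_contra h
        exact hL (mem_excSet_iff.mpr ⟨k, hk, lt_of_not_ge h⟩)
      rcases hcase.eq_or_lt with heq | hlt
      · -- `λ = 1/2`: both sides are `0`
        have hn0 : n = 0 := by
          rw [hn, ← heq]; norm_num
        have ha0 : a + Real.log 2 = 0 := by rw [← hlog2lam, ← heq]; norm_num
        rw [hn0, ha0]
        norm_num
      · -- `λ > 1/2`: `t > 0`, `j = ⌈t⌉ ≥ 1`, `k = j - 1`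
        have htpos : 0 < (a + Real.log 2) / Real.log 3 := by
          apply div_pos _ hlog3
          rw [← hlog2lam]
          exact Real.log_pos (by linarith)
        set j := ⌈(a + Real.log 2) / Real.log 3⌉ with hj
        have hj1 : 1 ≤ j := by
          have := Int.one_le_ceil_iff.mpr htpos
          exact this
        obtain ⟨k, hk⟩ : ∃ k : ℕ, (k : ℤ) = j - 1 := ⟨(j - 1).toNat, Int.toNat_of_nonneg (by omega)⟩
        have hjk : j = (k : ℤ) + 1 := by omega
        -- `3^k < 2λ ≤ 3^{k+1}`
        have hceil := (Int.ceil_eq_iff).mp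
          (show ⌈(a + Real.log 2) / Real.log 3⌉ = (k : ℤ) + 1 by rw [← hj]; exact hjk)
        have hk1 : (3 : ℝ) ^ k < 2 * lam := by
          have h := hceil.1
          push_cast at h
          rw [add_sub_cancel_right, lt_div_iff₀ hlog3] at h
          have : Real.log ((3 : ℝ) ^ k) < Real.log (2 * lam) := by
            rw [Real.log_pow, hlog2lam]; linarith
          exact (Real.log_lt_log_iff (by positivity) (by positivity)).mp this
        have hk2 : 2 * lam ≤ (3 : ℝ) ^ (k + 1) := by
          have h := hceil.2
          push_cast at h
          rw [div_le_iff₀ hlog3] at h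
          have : Real.log (2 * lam) ≤ Real.log ((3 : ℝ) ^ (k + 1)) := by
            rw [Real.log_pow, hlog2lam]; push_cast; linarith
          exact (Real.log_le_log_iff (by positivity) (by positivity)).mp this
        have hk3 : (3 : ℝ) ^ k + 1 ≤ 2 * lam := hnotL k hk1
        -- `3^k < 2n+1 ≤ 3^{k+1}`
        have hnle : (n : ℝ) ≤ lam := Nat.floor_le hlam0.le
        have hnlt : lam < n + 1 := Nat.lt_floor_add_one lam
        have hA : 3 ^ k < 2 * n + 1 := by
          have : (3 : ℝ) ^ k < 2 * n + 1 := by linarith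
          exact_mod_cast this
        have hB : 2 * n + 1 ≤ 3 ^ (k + 1) := by
          have h1 : (2 * n + 1 : ℝ) ≤ 3 ^ (k + 1) + 1 := by linarith
          have h2 : 2 * n + 1 ≤ 3 ^ (k + 1) + 1 := by exact_mod_cast h1
          have h3 : 2 * n + 1 ≠ 3 ^ (k + 1) + 1 := by
            intro h
            have := three_pow_mod_two (k + 1)
            omega
          omega
        rw [show (2 * (n : ℝ) + 1) = ((2 * n + 1 : ℕ) : ℝ) by push_cast; ring, ceil_log3_eq hA hB, hjk]
        ring
  · -- `deg D < -log 2`: `H⁰ = 0`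
    have hlt : lam < 1 / 2 := lt_of_not_ge hcase
    rw [hU1a hlt]
    have hn0 : n = 0 := by
      rw [hn, Nat.floor_eq_zero]; linarith
    have ht : (a + Real.log 2) / Real.log 3 < 0 := by
      apply div_neg_of_neg_of_pos _ hlog3
      rw [← hlog2lam]
      exact Real.log_neg (by positivity) (by linarith)
    have hL : a ∉ excSet := by
      intro h
      obtain ⟨k, hk1, -⟩ := mem_excSet_iff.mp h
      have : (1 : ℝ) ≤ 3 ^ k := one_le_pow₀ (by norm_num)
      linarith
    rw [Set.indicator_of_notMem hL, oddCeil_of_neg ht, hn0, hloglam]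
    push_cast
    rw [show Real.log (2 * 0 + 1) = 0 by norm_num]
    simp only [zero_div, Int.ceil_zero]
    rw [show (-a - Real.log 2) / Real.log 3 = -((a + Real.log 2) / Real.log 3) by ring, Int.ceil_neg]
    ring


/-- **Riemann–Roch for `\overline{Spec ℤ}` (Connes–Consani 2023, Thm. 4.3 = Thm. 1.1), PROVED**: discharges the
named fact `RiemannRoch_SpecZbar`:
`dim_{𝕊[±1]} H⁰(D) − dim_{𝕊[±1]} H¹(D) = ⌈(deg D + log 2)/log 3⌉' − 𝟙_L(deg D)` for every Arakelov divisor `D`.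
[cite: ConnesConsani2023RiemannRoch, Thm. 4.3 p. 10] -/
theorem RiemannRoch_SpecZbar_holds : RiemannRoch_SpecZbar :=
  RiemannRoch_SpecZbar_holds' dim_HZnorm_eq_holds

end Literature.NumberTheory.ConnesConsani2023

end
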